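import Mathlib
import Literature.Computability.AlgebraicComplexity.NestFreeMatchingPoly
import HarnessLib

/-!
# Nest-free (FIFO) perfect matchings: uniqueness from the opener set, a rank-potential criterion, forced letters

Helper file (def-free) for the support item stmt-ValiantsHypothesis-26254 (`Theses.FifoMatching.NFPolytopeQuasiPolyXC`, K1),
input (A) `QueueGridFaceProjection` of `Cruxes/NNLinearDegreeCofactorHard/Lines/queue_grid_face.lean`; SPEC
`Cruxes/NNLinearDegreeCofactorHard/Lines/queue_grid_face-A-SPEC.md` §3 (h1), §5 R1/R4.  Honesty: K1 open → open; stmt-23918 /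
stmt-24468 CLOSED, untouched; stmt-21181 open; VP ≠ VNP is not moved.

In the tree's encoding (`Literature/Computability/AlgebraicComplexity/NestFreeMatchingPoly.lean`) a perfect matching of the
ordered set `Fin m` is a fixed-point-free involution `M`, `i` is an OPENER if `i < M i` and a CLOSER if `M i < i`, and `M` is
nest-free if there are no `i < j < M j < M i`.  Nest-free = FIFO: the closers pop the openers in queue order.  This file proves
the three generic facts the queue-grid gadget runs on:

* `eq_of_forall_lt_iff` — **a nest-free perfect matching is determined by its set of openers** (two nest-free perfect
  matchings with the same openers are equal: at the least opener where they differ, the smaller of the two closers is popped,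
  in the other matching, by a later opener — a nesting) [folklore; e.g. Chen–Deng–Du–Stanley–Yan 2007 §1: nonnesting
  matchings ↔ standard Young tableaux of shape `(n,n)`, i.e. ↔ their opener sets];
* `mem_nestFreeMatchings_of_potential` — **rank-potential criterion**: a perfect matching admitting `ρ : Fin m → ℕ` that is
  constant on arcs and strictly increasing along the openers and along the closers is nest-free (for the FIFO matching,
  `ρ` = the rank of the arc) [folklore];
* `lt_of_forall_not_mem`, `gt_of_forall_not_mem` — **forced letters**: if all arcs of `M` lie in an arc set `E` and no arc of
  `E` ends (resp. starts) at `p`, then `p` is an opener (resp. a closer) [folklore];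
plus the small change (`lt_or_gt_of_mem_perfectMatchings`, `mem_arcs_of_gt`, `eq_of_forall_lt_eq`).

No definitions.  Reference: W. Y. C. Chen, E. Y. P. Deng, R. R. X. Du, R. P. Stanley, C. H. Yan, Trans. AMS 359 (2007), §1.
-/

-- Sub = Summit single-conjunct layout: the duplicated namespace component is mandated by the tree.
set_option linter.dupNamespace false

namespace Summit.ValiantsHypothesis.ValiantsHypothesis.Theorems.FifoMatching.QueueGridFace

open Finset Literature.Computability.AlgebraicComplexity

variable {m : ℕ}

/-- In a perfect matching every point is an opener or a closer. [folklore] -/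
theorem lt_or_gt_of_mem_perfectMatchings {M : Fin m → Fin m} (hM : M ∈ perfectMatchings m) (i : Fin m) :
    i < M i ∨ M i < i :=
  lt_or_gt_of_ne ((mem_perfectMatchings.1 hM).2 i).symm

/-- The partner of a closer is an opener whose partner is the closer: if `M p < p` then `M p < M (M p)`. [folklore] -/
theorem lt_apply_apply_of_gt {M : Fin m → Fin m} (hM : M ∈ perfectMatchings m) {p : Fin m} (hp : M p < p) :
    M p < M (M p) := by
  rwa [(mem_perfectMatchings.1 hM).1 p]

/-- If all arcs `(i, M i)`, `i < M i`, of a perfect matching lie in `E`, then so does the arc `(M p, p)` of every closer `p`.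
[folklore] -/
theorem mem_arcs_of_gt {M : Fin m → Fin m} (hM : M ∈ perfectMatchings m) {E : Set (Fin m × Fin m)}
    (hE : ∀ i, i < M i → (i, M i) ∈ E) {p : Fin m} (hp : M p < p) : (M p, p) ∈ E := by
  have h := hE (M p) (lt_apply_apply_of_gt hM hp)
  rwa [(mem_perfectMatchings.1 hM).1 p] at h

/-- **Forced opener.** If all arcs of the perfect matching `M` lie in `E` and no arc of `E` ends at `p`, then `p` is an
opener of `M`. [folklore] -/
theorem lt_of_forall_not_mem {M : Fin m → Fin m} (hM : M ∈ perfectMatchings m) {E : Set (Fin m × Fin m)}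
    (hE : ∀ i, i < M i → (i, M i) ∈ E) {p : Fin m} (hp : ∀ i, (i, p) ∉ E) : p < M p := by
  rcases lt_or_gt_of_mem_perfectMatchings hM p with h | h
  · exact h
  · exact absurd (mem_arcs_of_gt hM hE h) (hp _)

/-- **Forced closer.** If all arcs of the perfect matching `M` lie in `E` and no arc of `E` starts at `p`, then `p` is a
closer of `M`. [folklore] -/
theorem gt_of_forall_not_mem {M : Fin m → Fin m} (hM : M ∈ perfectMatchings m) {E : Set (Fin m × Fin m)}
    (hE : ∀ i, i < M i → (i, M i) ∈ E) {p : Fin m} (hp : ∀ j, (p, j) ∉ E) : M p < p := by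
  rcases lt_or_gt_of_mem_perfectMatchings hM p with h | h
  · exact absurd (hE p h) (hp _)
  · exact h

/-- **Rank-potential criterion for nest-freeness.** Let `M` be a perfect matching of `Fin m` and `ρ : Fin m → ℕ` be constant
on arcs (`ρ (M i) = ρ i` for openers `i`), strictly increasing along the openers and strictly increasing along the closers
(both in the order of `Fin m`).  Then `M` is nest-free: a nesting `i < j < M j < M i` would give `ρ i < ρ j` (openers) and
`ρ (M j) < ρ (M i)` (closers). [folklore] -/
theorem mem_nestFreeMatchings_of_potential {M : Fin m → Fin m} (hM : M ∈ perfectMatchings m) (ρ : Fin m → ℕ)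
    (harc : ∀ i, i < M i → ρ (M i) = ρ i)
    (hopen : ∀ i j, i < M i → j < M j → i < j → ρ i < ρ j)
    (hclose : ∀ i j, M i < i → M j < j → i < j → ρ i < ρ j) :
    M ∈ nestFreeMatchings m := by
  rw [mem_nestFreeMatchings]
  refine ⟨hM, fun i j hij hj hji => ?_⟩
  obtain ⟨hinv, -⟩ := mem_perfectMatchings.1 hM
  have hi : i < M i := hij.trans (hj.trans hji)
  have h1 := hopen i j hi hj hij
  have h2 := hclose (M j) (M i) (by rw [hinv]; exact hj) (by rw [hinv]; exact hi) hji
  rw [harc i hi, harc j hj] at h2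
  omega

/-- Two perfect matchings that agree on the openers of the first are equal. [folklore] -/
theorem eq_of_forall_lt_eq {M M' : Fin m → Fin m} (hM : M ∈ perfectMatchings m) (hM' : M' ∈ perfectMatchings m)
    (h : ∀ i, i < M i → M' i = M i) : M' = M := by
  obtain ⟨hinv, -⟩ := mem_perfectMatchings.1 hM
  obtain ⟨hinv', -⟩ := mem_perfectMatchings.1 hM'
  funext p
  rcases lt_or_gt_of_mem_perfectMatchings hM p with hp | hp
  · exact h p hp
  · have h1 : M' (M p) = p := by rw [h (M p) (lt_apply_apply_of_gt hM hp), hinv]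
    calc M' p = M' (M' (M p)) := by rw [h1]
      _ = M p := hinv' _

/-- One-sided step of `eq_of_forall_lt_iff`: if the perfect matching `M` and the NEST-FREE perfect matching `M'` have the
same openers and agree on the openers below the opener `i`, then `¬ M i < M' i` — otherwise the closer `M i` is popped in `M'`
by an opener `j` with `i < j < M' j = M i < M' i`, a nesting of `M'`. [folklore] -/
theorem not_apply_lt_apply {M M' : Fin m → Fin m} (hM : M ∈ perfectMatchings m) (hM' : M' ∈ nestFreeMatchings m)
    (h : ∀ i, i < M i ↔ i < M' i) {i : Fin m} (hi : i < M i) (ih : ∀ j < i, j < M j → M' j = M j) :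
    ¬ M i < M' i := by
  intro hlt
  obtain ⟨hM'p, hnest⟩ := mem_nestFreeMatchings.1 hM'
  obtain ⟨hinv, -⟩ := mem_perfectMatchings.1 hM
  obtain ⟨hinv', -⟩ := mem_perfectMatchings.1 hM'p
  -- `c := M i` is a closer of `M`, hence of `M'`
  have hc : M' (M i) < M i := by
    rcases lt_or_gt_of_mem_perfectMatchings hM'p (M i) with h' | h'
    · have h'' := (h (M i)).2 h'
      rw [hinv] at h''
      exact absurd hi (lt_asymm h'')
    · exact h'
  -- its `M'`-partner `j` is an opener distinct from `i`, not below `i`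
  set j := M' (M i) with hj
  have hjM' : j < M' j := by rw [hj, hinv']; exact hc
  have hjM : j < M j := (h j).2 hjM'
  have hji : j ≠ i := by
    intro e
    have h1 : M' j = M i := by rw [hj, hinv']
    rw [e] at h1
    rw [h1] at hlt
    exact lt_irrefl _ hlt
  have hij : i < j := by
    rcases lt_or_gt_of_ne hji with hlt' | hgt'
    · exfalso
      have e := ih j hlt' hjM
      rw [hj, hinv'] at e
      -- `M j = M i` with `j ≠ i` contradicts injectivity of `M`
      exact hji ((Function.Involutive.injective hinv) e.symm)
    · exact hgt'
  -- nesting `i < j < M' j = M i < M' i` in `M'`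
  have hMj : M' j = M i := by rw [hj, hinv']
  exact hnest i j hij hjM' (by rw [hMj]; exact hlt)

/-- **A nest-free perfect matching is determined by its opener set**: two nest-free perfect matchings of `Fin m` with the same
openers (`i < M i ↔ i < M' i`) are equal.  Least-counterexample induction over the openers, each side by
`not_apply_lt_apply`, then `eq_of_forall_lt_eq`. [folklore; Chen–Deng–Du–Stanley–Yan 2007, §1] -/
theorem eq_of_forall_lt_iff {M M' : Fin m → Fin m} (hM : M ∈ nestFreeMatchings m) (hM' : M' ∈ nestFreeMatchings m)
    (h : ∀ i, i < M i ↔ i < M' i) : M = M' := by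
  have hMp := nestFreeMatchings_subset_perfectMatchings hM
  have hM'p := nestFreeMatchings_subset_perfectMatchings hM'
  have key : ∀ k : ℕ, ∀ i : Fin m, i.val = k → i < M i → M' i = M i := by
    intro k
    induction k using Nat.strong_induction_on with
    | _ k IH =>
      intro i hik hi
      have ih : ∀ j < i, j < M j → M' j = M j := fun j hj hjM => IH j.val (hik ▸ hj) j rfl hjM
      have ih' : ∀ j < i, j < M' j → M j = M' j := fun j hj hjM' => (ih j hj ((h j).2 hjM')).symm
      by_contra hne
      rcases lt_or_gt_of_ne hne with hlt | hgt
      · exact not_apply_lt_apply hM'p hM (fun j => (h j).symm) ((h i).1 hi) ih' hlt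
      · exact not_apply_lt_apply hMp hM' h hi ih hgt
  exact (eq_of_forall_lt_eq hMp hM'p fun i hi => key i.val i rfl hi).symm

end Summit.ValiantsHypothesis.ValiantsHypothesis.Theorems.FifoMatching.QueueGridFace
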